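import Literature.AnabelianGeometry.EtaleTheta.Discharge.Sec5Thm57FinalKnitV6OfThetaSetting
import Literature.AnabelianGeometry.EtaleTheta.Discharge.Sec5Thm57KummerTorsionOfEtaleTower

/-!
# [EtTh] §5, Theorem 5.7 — FINAL KNIT v6 AT THE TOWER OF THE SETTING WITH THE (C) RESIDUAL `htorsfam` SUPPLIED BY THE ÉTALE SIDE:
# constant-multiple rigidity on the tower (Cor. 2.19 (iii) / Cor. 2.8 (i), F-0652 shape), translation-freeness, separation across levels,
# the pins (Prop. 5.2 (iii)) and Thm. 5.6 at each family member (pp. 324–331, 291, 268 / PDF pp. 98–105, 65, 42)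

Mochizuki, *The étale theta function and its Frobenioid-theoretic manifestations*, Publ. RIMS **45** (2009)
[cite: MochizukiEtTh2009, Thm 5.7 p.329–330 (PDF pp.103–104); Thm 5.6 p.328 (PDF p.102); Prop 5.2 (iii) p.324 (PDF p.98); Cor 2.19 (iii)
p.291 (PDF p.65); Cor 2.8 (i) p.268 (PDF p.42); Lem 5.8 p.331 (PDF p.105); Prop 3.2 (iii) p.296 (PDF p.70); Cor 2.18 (i) p.285–286
(PDF pp.59–60)].  abc-iut cell, layer L2, node `EtTh:Thm5.7`; abc-iut-L2-lead (gen 6) R798/R808 «(e3) COMPOSE» (seat abc-iut-w6-d049 gen 5, first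
refusal).  PROOF-ONLY (0 definitions, 0 new named facts; nothing landed is edited or restated): ONE application of abc-iut-f-123's (e1) Setting
twin `thetaRootPreservedAll_ofThetaSettingYddFamily_final_v6_of_cor218_i` (`Sec5Thm57FinalKnitV6OfThetaSetting.lean`) with its (C) binder
`htorsfam` := this seat's (e2) theorem `ThetaFrobenioidTower.kummerTorsion_of_etaleTower` (`Sec5Thm57KummerTorsionOfEtaleTower.lean`, p478416;
route p473560 → p476411 → p473372) applied member by member.

WHAT CHANGES vs (e1).  The displayed (C) binder `htorsfam` («for every family member `(a, b, w)` coherent with the constant normalised anchor,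
at every level `N ∈ Es`, the Kummer cocycle of `w^{2l}` along `H_{B_N}` is that of a torsion unit») is GONE; displayed instead are — ALL
INDEPENDENT OF THE FAMILY MEMBERS except the last:
* the §5 ↔ §2 dictionary at every level `M ∈ Es` of the tower of the Setting: `ι`, `hι` (`IdentifiesPiYdd`), `m_M`, abc-iut-L2-t4's
  `CyclotomicCharacterCompat` (`hχ`), the §5 `Facts` (`HF`), and the pins `ThetaSectionCompat` (Prop. 5.2 (iii)) of a COMPATIBLE family `η`
  of members of the collections (`η`, `hη`, `hηc`, `hpin`);
* the étale data on the tower `Cu.thetaEnvTower τ hC hS`: `(γ, γ_μ)` with `hstd` = VERBATIM the conclusion shape of abc-iut-L2-t2's FACT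
  `MuTwoSetting.Cor219_iii_std` (F-0652) at `l := T.l`, the glue `hγμχ` / `hγμred` / `haug` (PROVED generically in p476411), translation-freeness
  in pure étale currency `hinfη` (GAP G-L2d3-8's conclusion shape for the determined cocycle `κ^η`), separation across levels `hsep`;
* `hK4fam` — Thm. 5.6 at each family member: a base shadow `θ` with `θ(H_{B_N}) = H_{B_N}`, `s^trv_N` transported over `θ` (`StrvTransport`),
  `θ` compatible with `γ` (shadow law), and (K4m) `Ψ^Aut_b(m_N⁻¹ x) = m_N⁻¹(γ_μ,N x)` — quantified EXACTLY like `htorsfam` was.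
RESULT `thetaRootPreservedAll_ofThetaSettingYddFamily_final_v6_of_cor219iiiStd`: Thm. 5.7 (root level, all identifications) at every level of
the tower OF THE SETTING, MODULO the displayed binders of (e1) with `htorsfam` so replaced.
HONEST FRAMING: kernel-checked composition of landed theorems for data so parametrised (no instance of the class `TemperedFrobenioid T₀
(ConnectedPart (BTemp Π^tp_X̲̲)) VD` for an actual curve is constructed anywhere in the tree); none of the displayed binders is discharged here;
F-0620 / `Prop15iii` / the F-0652 SHAPE are FACT-policy labels or named residuals (nothing of [EtTh] is asserted unconditionally); typed ≠
discharged — PROVED modulo the displayed binders; no side taken on anything downstream ([IUTchIII] Cor. 3.12 in particular).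
-/

noncomputable section

namespace Literature.AnabelianGeometry.EtaleTheta

open CategoryTheory Opposite Literature.AlgebraicGeometry.Frobenioids Literature.AnabelianGeometry.SemiGraphs
  Literature.AnabelianGeometry.SemiGraphs.GaloisObjects

universe v₀ u₁ v₁

namespace ThetaFrobenioidTower

section SettingV6E

variable {p : ℕ} [Fact p.Prime] {DS : ThetaSetting p} {ES : DS.EtaleThetaData} {l' : ℕ} (Cu : ES.DoubleUnderline l')
  {e' : DS.toTemperedCurve.GroupLevelData} {Es : Set ℕ+} (τ : DS.CyclotomeTower l' Es) (hC : DS.Compat) (hS : DS.Sec2Hyps)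
  {D₀ : Type} [Category.{v₀} D₀] {V : FrdIMonoidStub.{0}} {T₀ : RealifiedDivisorMonoids (D₀ := D₀) V}
  {VD : FrdICatStub.{1, 0, 0} (ConnectedPart (BTemp (Cu.temperedArithmeticGroup e').Pi))}
  {tf : TemperedFrobenioid T₀ (ConnectedPart (BTemp (Cu.temperedArithmeticGroup e').Pi)) VD} {hZ : tf.monoidType = MonoidType.Z}
  {hP : ∀ A : (ConnectedPart (BTemp (Cu.temperedArithmeticGroup e').Pi))ᵒᵖ, IsPerfect (tf.Φ.carrier A)}
  {NH : Subgroup (Field.absoluteGaloisGroup DS.K) → tf.category → ℕ+ → Prop}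
  {pullFrac : ∀ {A A' : (BiKummerSetting.mkOfConnectedTemperoidYddTower (Cu.temperedArithmeticGroup e') tf hZ hP NH
      (Cu.thetaEnvTower τ hC hS) (ContinuousMulEquiv.refl _)).C} (_ : A' ⟶ A),
    (BiKummerSetting.mkOfConnectedTemperoidYddTower (Cu.temperedArithmeticGroup e') tf hZ hP NH (Cu.thetaEnvTower τ hC hS)
        (ContinuousMulEquiv.refl _)).biratUnits A →
      (BiKummerSetting.mkOfConnectedTemperoidYddTower (Cu.temperedArithmeticGroup e') tf hZ hP NH (Cu.thetaEnvTower τ hC hS)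
        (ContinuousMulEquiv.refl _)).biratUnits A'}
  {θ : (BiKummerSetting.mkOfConnectedTemperoidYddTower (Cu.temperedArithmeticGroup e') tf hZ hP NH (Cu.thetaEnvTower τ hC hS)
      (ContinuousMulEquiv.refl _)).biratUnits
    (BiKummerSetting.mkOfConnectedTemperoidYddTower (Cu.temperedArithmeticGroup e') tf hZ hP NH (Cu.thetaEnvTower τ hC hS)
      (ContinuousMulEquiv.refl _)).Aodot}
  {Bl : (BiKummerSetting.mkOfConnectedTemperoidYddTower (Cu.temperedArithmeticGroup e') tf hZ hP NH (Cu.thetaEnvTower τ hC hS)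
      (ContinuousMulEquiv.refl _)).C}
  {Pl : (BiKummerSetting.mkOfConnectedTemperoidYddTower (Cu.temperedArithmeticGroup e') tf hZ hP NH (Cu.thetaEnvTower τ hC hS)
      (ContinuousMulEquiv.refl _)).FractionPair θ Bl}
  {Rl : (BiKummerSetting.mkOfConnectedTemperoidYddTower (Cu.temperedArithmeticGroup e') tf hZ hP NH (Cu.thetaEnvTower τ hC hS)
      (ContinuousMulEquiv.refl _)).NthRoot θ Pl Cu.lPNat pullFrac}
  (h : ModelFrobenioid.Hypotheses tf.divisorMonoid tf.ratFnFunctor)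
  (Q : FrobenioidTheta.ThetaSubquotientStub.{0} (ConnectedPart (BTemp (Cu.temperedArithmeticGroup e').Pi)))
  (R : ∀ N : ℕ+, (BiKummerSetting.mkOfConnectedTemperoidYddTower (Cu.temperedArithmeticGroup e') tf hZ hP NH
      (Cu.thetaEnvTower τ hC hS) (ContinuousMulEquiv.refl _)).NthRoot Rl.root Rl.pair N pullFrac)
  (K' : Type) [Field K'] {X₀ : ConnectedPart (BTemp (Cu.temperedArithmeticGroup e').Pi)}
  (hX₀ : ∀ Y : ConnectedPart (BTemp (Cu.temperedArithmeticGroup e').Pi), Subsingleton (Y ⟶ X₀))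
  (t : ∀ N : ℕ+, (R N).BN.base ⟶ X₀) (c₀ : K'ˣ →* (tf.ratFnFunctor.obj (op X₀))ˣ)
  (hc₀ : Function.Injective c₀) (ht : ∀ N : ℕ+, Function.Injective (tf.ratFnFunctor.map (t N).op).hom)
  (hinvc : ∀ (N : ℕ+) (g : Aut (R N).AN.base),
    pull tf.divisorMonoid g.hom (ModelFrobenioid.div (R N).pair.num) = ModelFrobenioid.div (R N).pair.num)
  (hinvp : ∀ (N : ℕ+) (y : (Cu.thetaEnvTower τ hC hS).PiX), y ∈ (Cu.thetaEnvTower τ hC hS).PiYdd →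
    pull tf.divisorMonoid ((BiKummerSetting.mkOfConnectedTemperoidYddTower (Cu.temperedArithmeticGroup e') tf hZ hP NH
      (Cu.thetaEnvTower τ hC hS) (ContinuousMulEquiv.refl _)).galoisSurj (R N).AN.base (R N).αData.isGalois
        ((ContinuousMulEquiv.refl _) y)).hom (ModelFrobenioid.div (R N).pair.den) = ModelFrobenioid.div (R N).pair.den)
  (α : ∀ {N N' : ℕ+}, (N : ℕ) ∣ N' → ((R N').AN ⟶ (R N).AN))
  (β : ∀ {N N' : ℕ+}, (N : ℕ) ∣ N' → ((R N').BN ⟶ (R N).BN))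
  (comm_sCap : ∀ {N N' : ℕ+} (hd : (N : ℕ) ∣ N'), (R N').pair.num ≫ β hd = α hd ≫ (R N).pair.num)
  (comm_sCup : ∀ {N N' : ℕ+} (hd : (N : ℕ) ∣ N'), (R N').pair.den ≫ β hd = α hd ≫ (R N).pair.den)
  (isIsometry_α : ∀ {N N' : ℕ+} (hd : (N : ℕ) ∣ N'),
    ((BiKummerSetting.mkOfConnectedTemperoidYddTower (Cu.temperedArithmeticGroup e') tf hZ hP NH (Cu.thetaEnvTower τ hC hS)
      (ContinuousMulEquiv.refl _)).sec5Stub h).pre.IsIsometry (α hd))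
  (degFr_α : ∀ {N N' : ℕ+} (hd : (N : ℕ) ∣ N'),
    (((BiKummerSetting.mkOfConnectedTemperoidYddTower (Cu.temperedArithmeticGroup e') tf hZ hP NH (Cu.thetaEnvTower τ hC hS)
      (ContinuousMulEquiv.refl _)).sec5Stub h).pre.degFr (α hd) : ℕ) * N = N')
  (isIsometry_β : ∀ {N N' : ℕ+} (hd : (N : ℕ) ∣ N'),
    ((BiKummerSetting.mkOfConnectedTemperoidYddTower (Cu.temperedArithmeticGroup e') tf hZ hP NH (Cu.thetaEnvTower τ hC hS)
      (ContinuousMulEquiv.refl _)).sec5Stub h).pre.IsIsometry (β hd))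
  (degFr_β : ∀ {N N' : ℕ+} (hd : (N : ℕ) ∣ N'),
    (((BiKummerSetting.mkOfConnectedTemperoidYddTower (Cu.temperedArithmeticGroup e') tf hZ hP NH (Cu.thetaEnvTower τ hC hS)
      (ContinuousMulEquiv.refl _)).sec5Stub h).pre.degFr (β hd) : ℕ) * N = N')
  (baseFrob_α : ∀ {N N' : ℕ+} (hd : (N : ℕ) ∣ N'),
    (BiKummerSetting.mkOfConnectedTemperoidYddTower (Cu.temperedArithmeticGroup e') tf hZ hP NH (Cu.thetaEnvTower τ hC hS)
      (ContinuousMulEquiv.refl _)).IsOfBaseFrobeniusType (α hd))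
  -- the §4 package `h44` and its Thm. 4.4 clauses (as in '_final_v3')
  (h44 : BiKummerSetting.Thm44Hyp
    (BiKummerSetting.mkOfConnectedTemperoidYddTower (Cu.temperedArithmeticGroup e') tf hZ hP NH (Cu.thetaEnvTower τ hC hS)
      (ContinuousMulEquiv.refl _))
    (BiKummerSetting.mkOfConnectedTemperoidYddTower (Cu.temperedArithmeticGroup e') tf hZ hP NH (Cu.thetaEnvTower τ hC hS)
      (ContinuousMulEquiv.refl _)))
  (ψ : ∀ A : (BiKummerSetting.mkOfConnectedTemperoidYddTower (Cu.temperedArithmeticGroup e') tf hZ hP NH (Cu.thetaEnvTower τ hC hS)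
      (ContinuousMulEquiv.refl _)).C,
    (BiKummerSetting.mkOfConnectedTemperoidYddTower (Cu.temperedArithmeticGroup e') tf hZ hP NH (Cu.thetaEnvTower τ hC hS)
        (ContinuousMulEquiv.refl _)).biratUnits A ≃*
      (BiKummerSetting.mkOfConnectedTemperoidYddTower (Cu.temperedArithmeticGroup e') tf hZ hP NH (Cu.thetaEnvTower τ hC hS)
        (ContinuousMulEquiv.refl _)).biratUnits (h44.Ψ.functor.obj A))
  (hpull : ∀ {A A' : (BiKummerSetting.mkOfConnectedTemperoidYddTower (Cu.temperedArithmeticGroup e') tf hZ hP NH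
      (Cu.thetaEnvTower τ hC hS) (ContinuousMulEquiv.refl _)).C} (φ : A' ⟶ A)
    (f : (BiKummerSetting.mkOfConnectedTemperoidYddTower (Cu.temperedArithmeticGroup e') tf hZ hP NH (Cu.thetaEnvTower τ hC hS)
      (ContinuousMulEquiv.refl _)).biratUnits A),
      ψ A' (pullFrac φ f) = pullFrac (h44.Ψ.functor.map φ) (ψ A f))
  (hii : BiKummerSetting.Thm44_ii h44 ψ) (h3 : h44.PreservesFrobeniusStructure) (h4b : h44.PreservesBaseFrobeniusTypeData)
  (h8 : h44.PreservesAmple) (h15a : h44.PreservesFixedByHA ψ) (h15 : h44.PreservesSaturated ψ)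
  -- (B1)/(B1′): the Def. 4.1 (iv) datum of each transition `α_{1,N}`
  (D : ∀ N : ℕ+, (BiKummerSetting.mkOfConnectedTemperoidYddTower (Cu.temperedArithmeticGroup e') tf hZ hP NH (Cu.thetaEnvTower τ hC hS)
      (ContinuousMulEquiv.refl _)).BaseFrobeniusTypeData (α (one_dvd_level N)))

include hX₀ h hc₀ ht comm_sCap comm_sCup isIsometry_α degFr_α isIsometry_β degFr_β hpull hii h3 h4b h8 h15a h15 D in
/-- **[EtTh] Theorem 5.7 — FINAL KNIT v6 (root side) at the tower OF THE SETTING, (C) supplied by the étale side** — abc-iut-f-123's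
(e1) `thetaRootPreservedAll_ofThetaSettingYddFamily_final_v6_of_cor218_i` with `htorsfam := ` this seat's `kummerTorsion_of_etaleTower`
(p478416) member by member; see the module docstring for the binder census.
[cite: MochizukiEtTh2009, Thm 5.7 p.329–330 (PDF pp.103–104); Thm 5.6 p.328 (PDF p.102); Cor 2.19 (iii) p.291 (PDF p.65); Lem 5.8 p.331 (PDF p.105)] -/
theorem thetaRootPreservedAll_ofThetaSettingYddFamily_final_v6_of_cor219iiiStd
    (T : ThetaFrobenioidTower.{0} (BiKummerSetting.mkOfConnectedTemperoidYddTower (Cu.temperedArithmeticGroup e') tf hZ hP NH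
      (Cu.thetaEnvTower τ hC hS) (ContinuousMulEquiv.refl _)).C (ConnectedPart (BTemp (Cu.temperedArithmeticGroup e').Pi)))
    (hT : T = ofThetaSettingFamily τ hC hS h Q R K' (fun N => (Units.map (tf.ratFnFunctor.map (t N).op).hom).comp c₀)
      (fun N => tf.unitsMap_comp_injective (t N) hc₀ (ht N)) hinvc hinvp α β comm_sCap comm_sCup isIsometry_α degFr_α
      isIsometry_β degFr_β baseFrob_α)
    -- (A), residual of record: print's standing hypothesis "`Φ` non-dilating" (Prop. 5.1 / Thm. 4.4)
    (hnd : IsNonDilatingOn tf.divisorMonoid)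
    -- (A) Lemma 5.8's geometric connectedness at EVERY level `N`: «a unit of `B_N` commuting with `s^⊓-gp_N(Im Π^tp_Y̲)` is a constant»
    -- (displayed; its level-1 instance is what v1–v5 discharged from the ONE `ConstantsDictionary` junction binder)
    (hgc : ∀ (N : ℕ+) (u : (T.atLevel N).units (T.BN N)),
      (∀ y ∈ (T.atLevel N).imPiY, T.sgpCap N y * (u : Aut (T.BN N)) * (T.sgpCap N y)⁻¹ = u) →
        (T.atLevel N).unitsToBirat (T.BN N) u ∈ (T.constEmb N).range)
    -- (A) `hfac₁` RE-KEYED (p447915): Prop. 3.4 (ii) and the identification `D → D₀ → D^cnst ≅ aug_* ⋙ G` (`hYdd` is a theorem here)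
    {Dcnst : Type u₁} [Category.{v₁} Dcnst] (cnst : D₀ ⥤ Dcnst)
    (G : ConnectedPart (BTemp (Field.absoluteGaloisGroup DS.K)) ⥤ Dcnst)
    (ecn : tf.base ⋙ cnst ≅ QuasiTemperoid.pushforward (Cu.temperedArithmeticGroup e').aug.toMonoidHom
      (Cu.temperedArithmeticGroup e').aug_surjective (Cu.temperedArithmeticGroup e').augIsOpenMap_holds ⋙ G)
    (hP34 : RealifiedDivisorMonoids.Prop34Cnst T₀ cnst)
    -- the rendering law of `pullFrac`, the transitions over the base pair
    (hF : ∀ {B B' : (BiKummerSetting.mkOfConnectedTemperoidYddTower (Cu.temperedArithmeticGroup e') tf hZ hP NH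
        (Cu.thetaEnvTower τ hC hS) (ContinuousMulEquiv.refl _)).C} (φ : B' ⟶ B)
      (y : (BiKummerSetting.mkOfConnectedTemperoidYddTower (Cu.temperedArithmeticGroup e') tf hZ hP NH (Cu.thetaEnvTower τ hC hS)
        (ContinuousMulEquiv.refl _)).biratUnits B), pullFrac φ y = tf.pullFracModel φ y)
    (hαover : ∀ N : ℕ+, α (one_dvd_level N) ≫ (R 1).α = (R N).α)
    -- «`A_N^bs` characteristic in `Π^tp_X̲̲`» at EVERY level (the [EtTh] Prop. 2.4-class clause of '_final_v3'; abc-iut-w6-d077's residual)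
    (hcharAN : ∀ N : ℕ+, IsTopCharacteristic (Cu.temperedArithmeticGroup e').Pi
      (galoisSurjOf (Cu.temperedArithmeticGroup e').isTempered (R N).AN.base.obj (R N).αData.isGalois).ker)
    (hdivA : ∀ αA : h44.Ψ.functor.obj (T.AN 1) ≅ T.AN 1, ∃ ε : Aut (T.AN 1),
      T.pre.div (αA.inv ≫ h44.Ψ.functor.map (T.sCap 1)) = T.pre.div (ε.hom ≫ T.sCap 1) ∧
      T.pre.div (αA.inv ≫ h44.Ψ.functor.map (T.sCup 1)) = T.pre.div (ε.hom ≫ T.sCup 1))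
    -- (anchor) `hP24` RE-KEYED to the frozen FACT F-0620 ([EtTh] Cor. 2.18 (i)) at abc-iut-L2-t8's `Cu.rigidData μ' hC hS h15iii L`
    {N' : ℕ+} (μ' : DS.CyclotomeMod l' N') (h15iii : DS.Prop15iii ES hC) (L : Cu.CuspLabels)
    (h218i : (Cu.rigidData μ' hC hS h15iii L).Cor218_i)
    -- [EtTh] LEMMA 5.8 FOR CONSTANTS, print verbatim: «(K^×)^{1/N} ⊆ O^×(B_N^birat)» — every constant `c ∈ K'^×` read on `B_N^bs` (along
    -- `t N`) has an `N`-th root in `B(B_N^bs)^×` (p.331 (PDF p.105)); it feeds the root clause at the PRODUCED anchor (abc-iut-f-123, v5)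
    (h58N : ∀ (N : ℕ+) (c : K'ˣ), ∃ r : tf.biratUnitsModel (R N).BN,
      (r : tf.ratFnFunctor.obj (op (R N).BN.base)) ^ (N : ℕ) = (tf.ratFnFunctor.map (t N).op).hom (c₀ c : tf.ratFnFunctor.obj (op X₀)))
    -- [EtTh] Prop 4.2 (iv) L05 input OVER THE DOMAIN `A_1 := (R 1).AN` of the twisted level-1 pair: the roots-of-constants law (abc-iut-w4-d044's
    -- `hL`, GAP G-w4d044-1's shape at `A_1`; [FrdII] Rmk 2.2.1) — in v5 consumed ONLY by `Prop42Sub.unitRootsUpstairsAt_of_constantRootsAt`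
    (hL : ∀ (A'' : (BiKummerSetting.mkOfConnectedTemperoidYddTower (Cu.temperedArithmeticGroup e') tf hZ hP NH (Cu.thetaEnvTower τ hC hS)
        (ContinuousMulEquiv.refl _)).C) (N : ℕ+) (g : A''.base ⟶ (R 1).AN.base) (ξ : tf.ratFnFunctor.obj (op (R 1).AN.base)),
      (BiKummerSetting.mkOfConnectedTemperoidYddTower (Cu.temperedArithmeticGroup e') tf hZ hP NH (Cu.thetaEnvTower τ hC hS)
        (ContinuousMulEquiv.refl _)).IsFrobeniusTrivial A'' →
      (BiKummerSetting.mkOfConnectedTemperoidYddTower (Cu.temperedArithmeticGroup e') tf hZ hP NH (Cu.thetaEnvTower τ hC hS)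
        (ContinuousMulEquiv.refl _)).IsNHSaturatedBsFld
        (BiKummerSetting.mkOfConnectedTemperoidYddTower (Cu.temperedArithmeticGroup e') tf hZ hP NH (Cu.thetaEnvTower τ hC hS)
          (ContinuousMulEquiv.refl _)).HodotBsFld A'' N →
      divB tf.divisorMonoid tf.ratFnFunctor tf.divBNatTrans (op (R 1).AN.base) ξ = 1 →
        ∃ ζ : tf.ratFnFunctor.obj (op A''.base), ζ ^ (N : ℕ) = pull tf.ratFnFunctor g ξ)
    -- (C) SUPPLIED BY THE ÉTALE SIDE (abc-iut-w6-d049 p478416): `⋂_N (K^×)^N = 1` (Prop 3.2 (iii)) stays displayed …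
    (hK : ∀ x : T.Kˣ, (∀ N : ℕ+, ∃ d : T.Kˣ, d ^ (N : ℕ) = x) → x = 1)
    -- … the §5 ↔ §2 dictionary at every level `M ∈ Es` of the tower of the Setting (pins of a COMPATIBLE family `η`) …
    (ι : T.PiX ≃* (Cu.thetaEnvTower τ hC hS).PiX) (hι : ∀ y : T.PiX, y ∈ T.PiYdd ↔ ι y ∈ (Cu.thetaEnvTower τ hC hS).PiYdd)
    (m : ∀ M : Es, (T.atLevel M).muTorsion (T.atLevel M).BN (T.atLevel M).N ≃* ((Cu.thetaEnvTower τ hC hS).level M).mu)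
    (hχ : ∀ M : Es, (T.atLevel M).CyclotomicCharacterCompat ((Cu.thetaEnvTower τ hC hS).level M) ι (m M))
    (HF : ∀ M : Es, (T.atLevel M).Facts)
    (η : ∀ M : Es, (Cu.thetaEnvTower τ hC hS).PiYdd → (Cu.thetaEnvTower τ hC hS).mu M)
    (hη : ∀ M, η M ∈ (Cu.thetaEnvTower τ hC hS).thetaCocycles M)
    (hηc : ∀ (M M' : Es) (hd : (M : ℕ+) ∣ M'), (Cu.thetaEnvTower τ hC hS).red M M' hd ∘ η M' = η M)
    (hpin : ∀ M : Es, (T.atLevel M).ThetaSectionCompat (HF M) ((Cu.thetaEnvTower τ hC hS).level M) ι (m M) hι (η M))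
    -- … the étale data on the tower: `(γ, γ_μ)` with F-0652's conclusion SHAPE, glue, translation-freeness, separation across levels …
    (γ : (Cu.thetaEnvTower τ hC hS).PiX ≃ₜ* (Cu.thetaEnvTower τ hC hS).PiX)
    (hγ : (Cu.thetaEnvTower τ hC hS).PiYdd.map γ.toMulEquiv.toMonoidHom = (Cu.thetaEnvTower τ hC hS).PiYdd)
    (hγ' : ∀ x : (Cu.thetaEnvTower τ hC hS).PiX, x ∈ (Cu.thetaEnvTower τ hC hS).PiYdd → γ x ∈ (Cu.thetaEnvTower τ hC hS).PiYdd)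
    (γμ : ∀ M : Es, (Cu.thetaEnvTower τ hC hS).mu M ≃* (Cu.thetaEnvTower τ hC hS).mu M)
    (hstd : ∃ cf : ∀ M : Es, (Cu.thetaEnvTower τ hC hS).G → (Cu.thetaEnvTower τ hC hS).mu M,
      (∀ M, CycEnvelope.IsEnvCocycle (MonoidHom.id _) ((Cu.thetaEnvTower τ hC hS).chi M) (cf M)) ∧
      (∀ M, IsLocallyConstant (cf M ∘ (Cu.thetaEnvTower τ hC hS).aug)) ∧
      (∀ (M M' : Es) (hd : (M : ℕ+) ∣ M'), (Cu.thetaEnvTower τ hC hS).red M M' hd ∘ cf M' = cf M) ∧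
      (∀ M, (Cu.thetaEnvTower τ hC hS).pullbackCocycle M γ hγ (γμ M) '' (Cu.thetaEnvTower τ hC hS).thetaCocycles M =
        (fun η => η * (cf M ∘ (Cu.thetaEnvTower τ hC hS).aug ∘ (Cu.thetaEnvTower τ hC hS).PiYdd.subtype)) ''
          (Cu.thetaEnvTower τ hC hS).thetaCocycles M) ∧
      ∀ M : Es, ∃ d : (Cu.thetaEnvTower τ hC hS).mu M, ∀ g : (Cu.thetaEnvTower τ hC hS).G,
        cf M g ^ T.l = CycEnvelope.coboundary (MonoidHom.id _) ((Cu.thetaEnvTower τ hC hS).chi M) d g)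
    (hγμχ : ∀ (M : Es) (x : (Cu.thetaEnvTower τ hC hS).PiX) (tt : (Cu.thetaEnvTower τ hC hS).mu M),
      γμ M ((Cu.thetaEnvTower τ hC hS).chi M ((Cu.thetaEnvTower τ hC hS).aug x) tt) =
        (Cu.thetaEnvTower τ hC hS).chi M ((Cu.thetaEnvTower τ hC hS).aug (γ x)) (γμ M tt))
    (hγμred : ∀ (M M' : Es) (hd : (M : ℕ+) ∣ M') (tt : (Cu.thetaEnvTower τ hC hS).mu M'),
      (Cu.thetaEnvTower τ hC hS).red M M' hd (γμ M' tt) = γμ M ((Cu.thetaEnvTower τ hC hS).red M M' hd tt))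
    (haug : ∀ x y : (Cu.thetaEnvTower τ hC hS).PiX, (Cu.thetaEnvTower τ hC hS).aug x = (Cu.thetaEnvTower τ hC hS).aug y →
      (Cu.thetaEnvTower τ hC hS).aug (γ x) = (Cu.thetaEnvTower τ hC hS).aug (γ y))
    (hinfη : ∀ (M : Es) (k k' : (Cu.thetaEnvTower τ hC hS).PiYdd), (Cu.thetaEnvTower τ hC hS).aug k = (Cu.thetaEnvTower τ hC hS).aug k' →
      (η M k)⁻¹ * γμ M (η M ⟨γ.symm k, (Cu.thetaEnvTower τ hC hS).symm_apply_mem_PiYdd_of_map_eq γ hγ k k.2⟩) =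
        (η M k')⁻¹ * γμ M (η M ⟨γ.symm k', (Cu.thetaEnvTower τ hC hS).symm_apply_mem_PiYdd_of_map_eq γ hγ k' k'.2⟩))
    (hsep : ∀ η' : ∀ M : Es, (Cu.thetaEnvTower τ hC hS).PiYdd → (Cu.thetaEnvTower τ hC hS).mu M,
      (∀ M, η' M ∈ (Cu.thetaEnvTower τ hC hS).thetaCocycles M) →
      (∀ (M M' : Es) (hd : (M : ℕ+) ∣ M'), (Cu.thetaEnvTower τ hC hS).red M M' hd ∘ η' M' = η' M) →
      (∀ (M : Es) (k k' : (Cu.thetaEnvTower τ hC hS).PiYdd), (Cu.thetaEnvTower τ hC hS).aug k = (Cu.thetaEnvTower τ hC hS).aug k' →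
        η' M k * (η M k)⁻¹ = η' M k' * (η M k')⁻¹) →
      ∀ M : Es, ∃ d : (Cu.thetaEnvTower τ hC hS).mu M, ∀ k : (Cu.thetaEnvTower τ hC hS).PiYdd,
        (η' M k * (η M k)⁻¹) ^ 2 =
          CycEnvelope.coboundary ((Cu.thetaEnvTower τ hC hS).aug.comp (Cu.thetaEnvTower τ hC hS).PiYdd.subtype)
            ((Cu.thetaEnvTower τ hC hS).chi M) d k)
    -- … and Thm. 5.6 at each family member (base shadow `θ` with its laws, (K4m) at `γ_μ`), quantified EXACTLY like `htorsfam` was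
    (hK4fam : ∀ (α₁ : h44.Ψ.functor.obj (T.AN 1) ≅ T.AN 1) (β₁ : h44.Ψ.functor.obj (T.BN 1) ≅ T.BN 1) (u₁ : Aut (T.BN 1))
      (hu₁ : u₁ ∈ (T.atLevel 1).units (T.BN 1)),
      α₁.inv ≫ h44.Ψ.functor.map (T.sCap 1) ≫ β₁.hom = T.sCap 1 →
      α₁.inv ≫ h44.Ψ.functor.map (T.sCup 1) ≫ β₁.hom = T.sCup 1 ≫ u₁.hom →
      ∀ c : T.Kˣ, (T.atLevel 1).unitsToBirat (T.BN 1) ⟨u₁, hu₁⟩ = T.constEmb 1 c →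
      ∀ N (hN : N ∈ Es), ∀ (a : h44.Ψ.functor.obj (T.AN N) ≅ T.AN N) (b : h44.Ψ.functor.obj (T.BN N) ≅ T.BN N) (w : Aut (T.BN N)),
        w ∈ (T.atLevel N).units (T.BN N) →
        a.inv ≫ h44.Ψ.functor.map (T.sCap N) ≫ b.hom = T.sCap N →
        a.inv ≫ h44.Ψ.functor.map (T.sCup N) ≫ b.hom = T.sCup N ≫ w.hom →
        a.inv ≫ h44.Ψ.functor.map (T.α (one_dvd_level N)) ≫ α₁.hom = T.α (one_dvd_level N) →
        b.inv ≫ h44.Ψ.functor.map (T.β (one_dvd_level N)) ≫ β₁.hom = T.β (one_dvd_level N) →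
          ∃ θb : Aut (T.pre.base.obj (T.BN N)) ≃* Aut (T.pre.base.obj (T.BN N)),
            (T.atLevel N).HB.map θb.toMonoidHom = (T.atLevel N).HB ∧
            (T.atLevel N).StrvTransport h44.Ψ a (Iso.refl _) θb ∧
            (∀ k : T.PiYdd, θb (T.ρ N k) = T.ρ N (ι.symm (γ (ι k)))) ∧
            ∀ x : (Cu.thetaEnvTower τ hC hS).mu ⟨N, hN⟩, (T.atLevel N).psiAut h44.Ψ b
                (((m ⟨N, hN⟩).symm x : (T.atLevel N).muTorsion (T.atLevel N).BN (T.atLevel N).N) : Aut (T.atLevel N).BN) =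
              (((m ⟨N, hN⟩).symm (γμ ⟨N, hN⟩ x) : (T.atLevel N).muTorsion (T.atLevel N).BN (T.atLevel N).N) :
                Aut (T.atLevel N).BN)) :
    T.ThetaRootPreservedAll h44.Ψ := by
  refine thetaRootPreservedAll_ofThetaSettingYddFamily_final_v6_of_cor218_i Cu τ hC hS h Q R K' hX₀ t c₀ hc₀ ht hinvc hinvp α β
    comm_sCap comm_sCup isIsometry_α degFr_α isIsometry_β degFr_β baseFrob_α h44 ψ hpull hii h3 h4b h8 h15a h15 D T hT hnd hgc cnst G
    ecn hP34 hF hαover hcharAN hdivA μ' h15iii L h218i h58N hL hK ?_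
  intro α₁ β₁ u₁ hu₁ h₁ h₂ c hc N hN a b w hw hTa hTb hΨa hΨb
  -- the member's transport equations in the `(e, D_c, D_p) := (refl, 1, w)` shape of p458762 / p473560 (as in p445072)
  have hTr : a.inv ≫ h44.Ψ.functor.map (T.sCap N) ≫ b.hom = (Iso.refl (T.AN N)).hom ≫ T.sCap N ≫ (1 : Aut (T.BN N)).hom := by
    rw [hTa, Iso.refl_hom, Category.id_comp]
    show T.sCap N = T.sCap N ≫ (Iso.refl (T.BN N)).hom
    rw [Iso.refl_hom, Category.comp_id]
  have hTr' : a.inv ≫ h44.Ψ.functor.map (T.sCup N) ≫ b.hom = (Iso.refl (T.AN N)).hom ≫ T.sCup N ≫ w.hom := by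
    rw [hTb, Iso.refl_hom, Category.id_comp]
  -- Thm. 5.6 at the member (base shadow + (K4m)), then the étale instantiation (p478416); `Exists.elim` keeps the unifier cheap
  exact (hK4fam α₁ β₁ u₁ hu₁ h₁ h₂ c hc N hN a b w hw hTa hTb hΨa hΨb).elim fun θb hθ =>
    T.kummerTorsion_of_etaleTower h44.Ψ (Cu.thetaEnvTower τ hC hS) ι hι m hχ HF η hη hηc hpin γ hγ hγ' γμ hstd hγμχ hγμred haug
      hinfη hsep hN a b (Iso.refl _) w θb hθ.1 hTr hTr' hθ.2.1 hw hθ.2.2.1 hθ.2.2.2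

end SettingV6E

end ThetaFrobenioidTower

end Literature.AnabelianGeometry.EtaleTheta

end
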